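import Summits.Langlands.Langlands.Theses.PicardMuOrdinary

/-!
# Zariski-dense is not 3-adically dense (the gap between the infinite fern and `LimitConcl`)

Negative-lane remark for the crux `PicardMuOrdinary.MuOrdinaryFamilyRT` (stmt-Langlands-13757),
standing disprover refuter-cdisprove-stmt-Langlands-13757-g2-0, cycle 2 (2026-08-16).

The crux's conclusion `LimitConcl f` places `x_C` in the 3-ADIC closure of the regular algebraic
automorphic points of fixed tame level.  Deformation theory gives at best ZARISKI density of
automorphic points (Chenevier, *On the infinite fern of Galois representations of unitary type*,
Ann. ENS 2011, arXiv:0911.5726, Thm 8 for `U(3)` at a split `p`; Conj. 12 in general), and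
Chenevier records on the same page that density for the p-adic topology is NOT known.  The theorem
below is the minimal witness that the inference "Zariski-dense ⇒ 3-adically dense" is invalid:
in `ℤ₃` the points `3^(j+1)` are Zariski dense (a polynomial vanishing at all of them is `0`;
the analytic version is Strassmann's theorem) while `6 = 2·3` stays at distance exactly `1/3` from
every one of them.  Moral recorded in `Cruxes/MuOrdinaryFamilyRT/Disproof.lean` F8: every line
must produce a family through `x_C` finite over weight space; "x_C is a point of the big Hecke
algebra" alone does not give `LimitConcl`.
-/

namespace Summit.Langlands.Langlands.Theorems.MuOrdinaryFamilyRT.Negative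

set_option linter.dupNamespace false

open Polynomial


/-- `‖(2 : ℤ₃)‖ = 1`. [folklore] -/
theorem norm_two_padicInt : ‖(2 : ℤ_[3])‖ = 1 := by
  apply le_antisymm (PadicInt.norm_le_one _)
  by_contra h
  push Not at h
  have : ‖((2 : ℤ) : ℤ_[3])‖ < 1 := by simpa using h
  rw [PadicInt.norm_int_lt_one_iff_dvd] at this
  omega

/-- `‖2 − 3^j‖₃ = 1` for every `j`. [folklore] -/
theorem norm_two_sub_three_pow (j : ℕ) : ‖(2 : ℤ_[3]) - 3 ^ j‖ = 1 := by
  rcases Nat.eq_zero_or_pos j with rfl | hj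
  · norm_num
  · have h3 : ‖((3 : ℤ_[3]) ^ j)‖ < 1 := by
      rw [norm_pow]
      have : ‖(3 : ℤ_[3])‖ = (3 : ℝ)⁻¹ := by simpa using PadicInt.norm_p (p := 3)
      rw [this]
      calc ((3 : ℝ)⁻¹) ^ j ≤ (3 : ℝ)⁻¹ ^ 1 := pow_le_pow_of_le_one (by norm_num) (by norm_num) hj
        _ < 1 := by norm_num
    have hne : ‖(2 : ℤ_[3])‖ ≠ ‖(-(3 : ℤ_[3]) ^ j)‖ := by
      rw [norm_neg, norm_two_padicInt]; exact (ne_of_gt h3)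
    rw [sub_eq_add_neg, PadicInt.norm_add_eq_max_of_ne hne, norm_neg, norm_two_padicInt]
    exact max_eq_left h3.le

/-- **Toy witness (F8).** In the closed unit disc `ℤ₃`, the "classical" points `3^(j+1)` are
ZARISKI dense — a polynomial vanishing at all of them is zero — yet the point `6 = 2·3` stays at
3-adic distance exactly `1/3` from every one of them.  Moral for this crux: Zariski density /
accumulation of automorphic points (Chenevier's infinite fern for `U(3)`, Zariski density of
crystalline points in local deformation rings) does NOT give the 3-ADIC accumulation at fixed tame
level that `LimitConcl` demands; every line needs a finiteness-over-weight-space (dominance)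
structure through `x_C`, which is exactly what is missing for the λ-supersingular / wild members
(the remainder stubs). [folklore] -/
theorem zariskiDense_not_padicallyDense :
    (∀ F : Polynomial ℤ_[3], (∀ j : ℕ, F.eval ((3 : ℤ_[3]) ^ (j + 1)) = 0) → F = 0) ∧
      ∀ j : ℕ, ‖(6 : ℤ_[3]) - 3 ^ (j + 1)‖ = 3⁻¹ := by
  constructor
  · intro F hF
    apply Polynomial.eq_zero_of_infinite_isRoot
    have hinj : Function.Injective (fun j : ℕ => (3 : ℤ_[3]) ^ (j + 1)) := by
      intro j k hjk
      have := congrArg (fun z : ℤ_[3] => ‖z‖) hjk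
      simp only [norm_pow] at this
      have h3 : ‖(3 : ℤ_[3])‖ = (3 : ℝ)⁻¹ := by simpa using PadicInt.norm_p (p := 3)
      rw [h3] at this
      have := pow_right_injective₀ (by norm_num : (0 : ℝ) < 3⁻¹) (by norm_num) this
      omega
    refine Set.infinite_of_injective_forall_mem hinj ?_
    intro j
    exact hF j
  · intro j
    have : (6 : ℤ_[3]) - 3 ^ (j + 1) = 3 * (2 - 3 ^ j) := by ring
    rw [this, norm_mul, norm_two_sub_three_pow, mul_one]
    simpa using PadicInt.norm_p (p := 3)


end Summit.Langlands.Langlands.Theorems.MuOrdinaryFamilyRT.Negative
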